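import Literature.AlgebraicGeometry.ModuliOfAbelianVarieties.SiegelShimuraSetIndexRepresentatives
import Literature.AlgebraicGeometry.ModuliOfAbelianVarieties.SiegelModuliInterpretation
import Literature.AlgebraicGeometry.ModuliOfAbelianVarieties.SiegelPrincipalLevelOpen
import HarnessLib

/-!
# `GSp_δ(𝔸_{ℚ,f}) = GSp_δ(ℚ) · K_δ(1)` and SYMPLECTIC basis matrices of the lattices `Λ_a`: the polarisation type of a marked torus

Topic `AlgebraicGeometry/ModuliOfAbelianVarieties`; namespace `Literature.AlgebraicGeometry.ModuliOfAbelianVarieties`.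
THEOREMS ONLY (no definition, no named fact, no instance, no `sorry`); everything consumed BY NAME:
★ R60-21B′ `SiegelShimuraSet.doubleCosetMk_eq_integral_diag` (class number one for `GSp_δ` in double-coset form),
★ `isOpen_principalLevelSubgroup` (R60-18 neighbourhood), ★ T1′ `IsLatticeBasis` / `isLatticeBasis_iff_latticeOfGL_eq` /
`IsLatticeBasis.mul_of_mem_principalLevelSubgroup_one` (`SiegelModuliInterpretation`), ★ R60-20
`exists_mem_similitudeGroupOfForm_typeFormOver_isMultiplier` (the rational section `u ↦ diag(1_g, u·1_g)`), ★ R60-4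
`exists_mem_principalLevelSubgroup_isMultiplier` / `sub_one_mem_levelIdeal_of_isMultiplier_of_isPolarizationType`
(`ν(K_δ(N)) = 𝓞̂^× ∩ (1 + N·𝓞̂)`), ★ `exists_int_cast_eq_of_algebraMap_mem_integralAdeles` (`ℚ ∩ ℤ̂ = ℤ`), ★ R60-12
`forall_valued_eq_one_iff_mem_integralAdeles` (the `ℤ̂^×` bridge).

* §1 **`GSp_δ(𝔸_{ℚ,f}) = GSp_δ(ℚ) · K_δ(1)` on ELEMENTS** (`exists_gspRationalToFinAdelic_mul_eq`): every `a ∈ GSp_δ(𝔸_{ℚ,f})`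
  is `a = q̂ · k` with `q ∈ GSp_δ(ℚ)` and `k ∈ K_δ(1) = GSp_δ(ℤ̂)` (`0 < δ_i`) — the element form of ★ R60-21B′ at the open
  subgroup `K = K_δ(1)` ([Milne2005ShimuraVarieties] §4 Thm. 4.16 and Lemma 5.12; [PlatonovRapinchuk1994] §8.1); the SIGN
  FLIP `diag(1_g, −1_g) ∈ GSp_δ(ℚ) ∩ K_δ(1)` (multiplier `−1`) makes the rational factor's multiplier POSITIVE
  (`exists_gspRationalToFinAdelic_mul_eq_of_pos`).
* §2 **SYMPLECTIC basis matrices** (`exists_isLatticeBasis_isMultiplier_pos`, the head): for every `a ∈ GSp_δ(𝔸_{ℚ,f})` the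
  lattice `Λ_a = ℚ^{2g} ∩ a·ℤ̂^{2g}` has a basis matrix `q ∈ GSp_δ(ℚ)` (★ T1′ `IsLatticeBasis a q`, i.e. `Λ_a = q ℤ^{2g}`, ★
  R60-19 `latticeOfGL a = latticeOfGL q̂`) which is a rational symplectic SIMILITUDE with a positive multiplier
  `c = c(a) ∈ ℚ_{>0}`: `qᵀ E_δ q = c • E_δ`.  READING (the «type» clause of [Milne2005ShimuraVarieties] Thm. 6.11 / of the
  triple `(A, λ, ηK)` attached to a point `[J, a]`; [Deligne1971TravauxShimura] 4.16, proof of 4.21 (a) «`T(B) = k⁻¹(V_ẑ)`»):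
  in the `ℤ`-basis of `Λ_a` given by the columns of `q` the alternating form `c(a)⁻¹ ψ_δ` has Gram matrix `E_δ = typeForm δ`,
  i.e. the polarisation `± c(a)⁻¹ ψ_δ` of the torus `(V_ℝ, J)/Λ_a` is INTEGRAL OF TYPE `δ` — stated DEF-FREE, in the tree's
  `IsMultiplier (typeFormOver δ ℚ) q c` currency (no new predicate «of type δ»).
* §3 **The type scalar `c(a)` is well defined** (`0 < g`, `δ` a polarisation type): two factorisations `a = q̂ k = q̂′ k′` differ
  by `q⁻¹ q′ ∈ GSp_δ(ℚ) ∩ K_δ(1) = GSp_δ(ℤ)`, whose multiplier is a rational `ℤ̂`-unit, i.e. `±1`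
  (`isMultiplier_eq_one_or_eq_neg_one_of_mem_principalLevelSubgroup_one`); hence the positive multiplier is unique
  (`eq_of_isMultiplier_pos_of_mul_eq_mul`), and `ν(a) = ĉ(a) · t` with `t ∈ ℤ̂^×` (`exists_isMultiplier_map_mul_of_mul_eq`), so
  `c(a)` is the positive generator of `ν(a) ℤ̂^× ℚ^× ∩ ℚ^×`.

Cell `hodgecm-mathlib` (D-0151), #60 / M1′ road: M1PRIME-DAG (B-plan1) §3 node N6, ANNEX B (B-typ04) §2 row **J1-i, TYPE HALF**
(«marking ⇒ triple of type δ»: the polarisation-type bookkeeping of the `pts`-convention node; B-plan1 routing word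
2026-08-28T21:16:34Z).  Banked generic leaf toward #60, books 0.  Neighbours not touched: J1-ii (B-p18, markings ⇒ same point),
I1 (B-p04 / B-p09 / B-p14), the analytic↔algebraic Weil-pairing bridge G2.
HC_CM is proved only modulo the 7 printed citations until rung 0 closes.

## References
* [Milne2005ShimuraVarieties] J. S. Milne, *Introduction to Shimura varieties* (2005; 2017 revision pages), §4 Thm. 4.16 and
  Rem. 4.17 (a) p. 48 (strong approximation, class number one), §5 Lemma 5.12 and Lemma 5.13 p. 57, §6 p. 67 (`GSp(ψ)`, `ν(g)`),
  Thm. 6.11 p. 74 and p. 75 (`V(ℤ̂)`-lattices, the triple `(A, s, ηK)` with `± s` a polarisation).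
* [Deligne1971TravauxShimura] P. Deligne, *Travaux de Shimura*, Sém. Bourbaki 389 (1971), Exemple 4.16 p. 150, Thm. 4.21 and its
  proof (a) p. 152.
* [PlatonovRapinchuk1994] V. Platonov, A. Rapinchuk, *Algebraic groups and number theory* (1994), §8.1 (class number of `GL_n`,
  `GSp_{2g}` over `ℚ`).
* [GenestierNgo2020] A. Genestier, B. C. Ngô, *Lectures on Shimura varieties*, §1.2 (symplectic basis of type `D`).
-/

set_option autoImplicit false

noncomputable section

open Matrix NumberField IsDedekindDomain
open _root_.Topology

namespace Literature.AlgebraicGeometry.ModuliOfAbelianVarieties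

variable {g : ℕ} (δ : Fin g → ℕ)

/-! ### §1. `GSp_δ(𝔸_{ℚ,f}) = GSp_δ(ℚ) · K_δ(1)` on elements, with a positive rational multiplier -/

section ClassNumberOne

/-- **`GSp_δ(𝔸_{ℚ,f}) = GSp_δ(ℚ) · K_δ(1)`**: every finite-adelic symplectic similitude `a` of type `δ` (`0 < δ_i`) is
`a = q̂ · k` with `q ∈ GSp_δ(ℚ)` and `k ∈ K_δ(1) = GSp_δ(ℤ̂)` — the element form of ★ R60-21B′
`SiegelShimuraSet.doubleCosetMk_eq_integral_diag` at the OPEN subgroup `K_δ(1)` (class number one of `GSp_δ` over `ℚ`: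
strong approximation for `Sp` + `𝔸_f^× = ℚ_{>0}·ℤ̂^×`). [cite: Milne2005ShimuraVarieties, §4 Thm. 4.16 and Rem. 4.17 (a) p. 48, Lemma 5.12 p. 57]
[cite: PlatonovRapinchuk1994, §8.1] -/
theorem exists_gspRationalToFinAdelic_mul_eq (hδ : ∀ i, 0 < δ i) (a : gspFinAdelic δ) :
    ∃ (q : gspRational δ) (k : gspFinAdelic δ), k ∈ principalLevelSubgroup δ 1 ∧ gspRationalToFinAdelic δ q * k = a := by
  obtain ⟨u, x, -, hx1, -, -, hax⟩ := SiegelShimuraSet.doubleCosetMk_eq_integral_diag δ (principalLevelSubgroup δ 1) hδ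
    (isOpen_principalLevelSubgroup δ one_ne_zero) a
  obtain ⟨h, ⟨γ, rfl⟩, k, hk, hx⟩ := (DoubleCoset.eq _ _ _ _).1 hax
  -- `x = γ̂ a k`, so `a = γ̂⁻¹ (x k⁻¹)`
  refine ⟨γ⁻¹, x * k⁻¹, Subgroup.mul_mem _ hx1 (Subgroup.inv_mem _ hk), ?_⟩
  rw [hx, map_inv]
  group

/-- **The sign flip**: `diag(1_g, −1_g)` is a rational symplectic similitude of type `δ` with multiplier `−1` whose adelic image
lies in `K_δ(1) = GSp_δ(ℤ̂)` (it is integral with integral inverse) — the `u = −1` values of the rational section ★ R60-20 and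
of the integral section ★ R60-4 coincide. [cite: Deligne1971TravauxShimura, Exemple 4.16 p. 150]
[cite: Milne2005ShimuraVarieties, §6 p. 67] -/
theorem exists_gspRational_isMultiplier_neg_one_mem_principalLevelSubgroup_one :
    ∃ d : gspRational δ, IsMultiplier (typeFormOver δ ℚ) (d : GL (Fin g ⊕ Fin g) ℚ) (-1) ∧
      gspRationalToFinAdelic δ d ∈ principalLevelSubgroup δ 1 := by
  -- the rational section at `-1`
  obtain ⟨d, hd, hdm, hdc⟩ := exists_mem_similitudeGroupOfForm_typeFormOver_isMultiplier δ ℚ (-1)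
  -- the integral section at `-1`
  have h2 : ((-1 : finAdeleQˣ) : finAdeleQ) - 1 ∈ levelIdeal 1 := by
    rw [mem_levelIdeal_iff]
    refine ⟨(-1 : finAdeleQ) - 1, Subring.sub_mem _ (Subring.neg_mem _ (Subring.one_mem _)) (Subring.one_mem _), ?_⟩
    rw [Nat.cast_one, one_mul, Units.val_neg, Units.val_one]
  have h2' : (((-1 : finAdeleQˣ)⁻¹ : finAdeleQˣ) : finAdeleQ) - 1 ∈ levelIdeal 1 := by rwa [inv_neg, inv_one]
  obtain ⟨x, hx1, -, hxc⟩ := exists_mem_principalLevelSubgroup_isMultiplier δ (N := 1) (-1) h2 h2'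
  refine ⟨⟨d, hd⟩, hdm, ?_⟩
  -- the two sections agree as adelic matrices
  have hdx : gspRationalToFinAdelic δ ⟨d, hd⟩ = x := by
    refine Subtype.ext (Units.ext ?_)
    rw [hxc, coe_gspRationalToFinAdelic]
    change (d : Matrix (Fin g ⊕ Fin g) (Fin g ⊕ Fin g) ℚ).map (algebraMap ℚ finAdeleQ) = _
    rw [hdc, Units.val_neg, Units.val_one, Units.val_neg, Units.val_one, neg_smul, one_smul, neg_smul, one_smul,
      Matrix.fromBlocks_map, Matrix.map_neg, Matrix.map_zero _ (map_zero _),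
      Matrix.map_one _ (map_zero _) (map_one _)]
    exact fun y => map_neg _ y
  rw [hdx]
  exact hx1

/-- **`GSp_δ(𝔸_{ℚ,f}) = GSp_δ(ℚ)⁺_E · K_δ(1)` with a POSITIVE multiplier**: every `a ∈ GSp_δ(𝔸_{ℚ,f})` (`0 < δ_i`) is `a = q̂ · k`
with `k ∈ K_δ(1)` and `q ∈ GSp_δ(ℚ)` of multiplier `c ∈ ℚ_{>0}` (`qᵀ E_δ q = c • E_δ`) — multiply the rational factor of
`exists_gspRationalToFinAdelic_mul_eq` by the sign flip `diag(1_g, −1_g) ∈ GSp_δ(ℚ) ∩ K_δ(1)` if its multiplier is negative.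
[cite: Milne2005ShimuraVarieties, §4 Thm. 4.16 p. 48, Lemma 5.12 p. 57, §6 p. 67] [cite: PlatonovRapinchuk1994, §8.1] -/
theorem exists_gspRationalToFinAdelic_mul_eq_of_pos (hδ : ∀ i, 0 < δ i) (a : gspFinAdelic δ) :
    ∃ (q : gspRational δ) (c : ℚˣ) (k : gspFinAdelic δ), 0 < (c : ℚ) ∧
      IsMultiplier (typeFormOver δ ℚ) (q : GL (Fin g ⊕ Fin g) ℚ) c ∧
      k ∈ principalLevelSubgroup δ 1 ∧ gspRationalToFinAdelic δ q * k = a := by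
  obtain ⟨q, k, hk, hqk⟩ := exists_gspRationalToFinAdelic_mul_eq δ hδ a
  obtain ⟨c, hc⟩ := q.2
  rcases lt_or_gt_of_ne (Units.ne_zero c) with hneg | hpos
  · -- flip the sign
    obtain ⟨d, hdm, hd1⟩ := exists_gspRational_isMultiplier_neg_one_mem_principalLevelSubgroup_one δ
    refine ⟨q * d, c * (-1), (gspRationalToFinAdelic δ d)⁻¹ * k, ?_, ?_,
      Subgroup.mul_mem _ (Subgroup.inv_mem _ hd1) hk, ?_⟩
    · rw [Units.val_mul, Units.val_neg, Units.val_one, mul_neg, mul_one]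
      exact neg_pos.2 hneg
    · rw [Subgroup.coe_mul]
      exact hc.mul hdm
    · rw [map_mul, ← hqk]
      group
  · exact ⟨q, c, k, hpos, hc, hk, hqk⟩

end ClassNumberOne

/-! ### §2. Symplectic basis matrices of `Λ_a`: the polarisation type of the marked torus -/

section SymplecticBasis

/-- **`Λ_{q̂} = q ℤ^{2g}` for rational `q`**: a rational symplectic similitude IS a basis matrix of the lattice of its own adelic
image (★ T1′ `IsLatticeBasis`; via the junction ★ `isLatticeBasis_iff_latticeOfGL_eq` this is `rfl`).
[cite: Milne2005ShimuraVarieties, §6 Thm. 6.11 p. 74 and p. 75] -/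
theorem isLatticeBasis_gspRationalToFinAdelic (q : gspRational δ) :
    IsLatticeBasis (gspRationalToFinAdelic δ q) (q : GL (Fin g ⊕ Fin g) ℚ) :=
  (isLatticeBasis_iff_latticeOfGL_eq _ _).2 rfl

variable {δ} in
/-- **`Λ_{q̂ k} = q ℤ^{2g}` for `k ∈ K_δ(1)`**: the rational factor of a factorisation `a = q̂ · k` is a basis matrix of `Λ_a`
(★ T1′ `IsLatticeBasis.mul_of_mem_principalLevelSubgroup_one`: `Λ_{a k} = Λ_a` for `k ∈ GSp_δ(ℤ̂)`).
[cite: Milne2005ShimuraVarieties, §4 pp. 48–49, §6 p. 75] -/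
theorem isLatticeBasis_of_gspRationalToFinAdelic_mul_eq {q : gspRational δ} {k a : gspFinAdelic δ}
    (hk : k ∈ principalLevelSubgroup δ 1) (h : gspRationalToFinAdelic δ q * k = a) :
    IsLatticeBasis a (q : GL (Fin g ⊕ Fin g) ℚ) := by
  rw [← h]
  exact (isLatticeBasis_gspRationalToFinAdelic δ q).mul_of_mem_principalLevelSubgroup_one hk

/-- **HEAD — every `Λ_a` has a SYMPLECTIC basis matrix with positive multiplier** (`0 < δ_i`): for `a ∈ GSp_δ(𝔸_{ℚ,f})` there are
`q ∈ GSp_δ(ℚ)` and `c ∈ ℚ_{>0}` with `qᵀ E_δ q = c • E_δ` (`IsMultiplier`), `Λ_a = q ℤ^{2g}` (`IsLatticeBasis a q`), and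
`a = q̂ · k`, `k ∈ K_δ(1)`.  READING: in the `ℤ`-basis of `Λ_a = ℚ^{2g} ∩ a·ℤ̂^{2g}` given by the columns of `q` the form
`c⁻¹ ψ_δ` has Gram matrix `E_δ` — the polarisation `± c(a)⁻¹ ψ_δ` of the marked torus `(V_ℝ, J)/Λ_a` of a point `[J, a]` is
integral OF TYPE `δ` (the «type» clause of the triple `(A, ± s, ηK)`; «`T(B) = k⁻¹(V_ẑ)`»).
[cite: Milne2005ShimuraVarieties, §6 p. 67, Thm. 6.11 p. 74 and p. 75] [cite: Deligne1971TravauxShimura, Exemple 4.16 p. 150, proof of Thm. 4.21 (a) p. 152]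
[cite: GenestierNgo2020, §1.2] -/
theorem exists_isLatticeBasis_isMultiplier_pos (hδ : ∀ i, 0 < δ i) (a : gspFinAdelic δ) :
    ∃ (q : gspRational δ) (c : ℚˣ), 0 < (c : ℚ) ∧ IsMultiplier (typeFormOver δ ℚ) (q : GL (Fin g ⊕ Fin g) ℚ) c ∧
      IsLatticeBasis a (q : GL (Fin g ⊕ Fin g) ℚ) ∧
      ∃ k ∈ principalLevelSubgroup δ 1, gspRationalToFinAdelic δ q * k = a := by
  obtain ⟨q, c, k, hc0, hc, hk, hqk⟩ := exists_gspRationalToFinAdelic_mul_eq_of_pos δ hδ a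
  exact ⟨q, c, hc0, hc, isLatticeBasis_of_gspRationalToFinAdelic_mul_eq hk hqk, k, hk, hqk⟩

/-- ★ R60-19 spelling of the head: **`latticeOfGL a = latticeOfGL q̂` (`Λ_a = q ℤ^{2g}`) for a rational symplectic similitude `q`
with positive multiplier** (`0 < δ_i`). [cite: Milne2005ShimuraVarieties, §6 Thm. 6.11 p. 74 and p. 75] [cite: PlatonovRapinchuk1994, §8.1] -/
theorem exists_latticeOfGL_eq_isMultiplier_pos (hδ : ∀ i, 0 < δ i) (a : gspFinAdelic δ) :
    ∃ (q : gspRational δ) (c : ℚˣ), 0 < (c : ℚ) ∧ IsMultiplier (typeFormOver δ ℚ) (q : GL (Fin g ⊕ Fin g) ℚ) c ∧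
      Literature.NumberTheory.Adeles.latticeOfGL (a : GL (Fin g ⊕ Fin g) finAdeleQ) =
        Literature.NumberTheory.Adeles.latticeOfGL
          (Matrix.GeneralLinearGroup.map (algebraMap ℚ finAdeleQ) (q : GL (Fin g ⊕ Fin g) ℚ)) := by
  obtain ⟨q, c, hc0, hc, hqa, -⟩ := exists_isLatticeBasis_isMultiplier_pos δ hδ a
  exact ⟨q, c, hc0, hc, (isLatticeBasis_iff_latticeOfGL_eq _ _).1 hqa⟩

/-- **The Gram matrix on the basis, entrywise**: for a similitude `q` of multiplier `c` and the standard basis `e_i`,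
`ψ_δ(q e_i, q e_j) = c · (E_δ)_{ij}` — `(qᵀ E_δ q)_{ij} = c · (E_δ)_{ij}` (unfolding of `IsMultiplier`; recorded so that consumers
reading the polarisation type on basis vectors need not unfold). [cite: Milne2005ShimuraVarieties, §6 p. 67] [cite: GenestierNgo2020, §1.2] -/
theorem transpose_mul_typeFormOver_mul_apply_of_isMultiplier {R : Type*} [CommRing R] {q : GL (Fin g ⊕ Fin g) R} {c : Rˣ}
    (hq : IsMultiplier (typeFormOver δ R) q c) (i j : Fin g ⊕ Fin g) :
    ((q : Matrix (Fin g ⊕ Fin g) (Fin g ⊕ Fin g) R)ᵀ * typeFormOver δ R * (q : Matrix (Fin g ⊕ Fin g) (Fin g ⊕ Fin g) R)) i j =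
      (c : R) * ((typeForm δ i j : ℤ) : R) := by
  rw [isMultiplier_iff.1 hq, Matrix.smul_apply, typeFormOver_apply, smul_eq_mul]

end SymplecticBasis

/-! ### §3. The type scalar `c(a)` is well defined -/

section TypeScalar

/-- **`ν(GSp_δ(ℤ)) = {±1}`**: a RATIONAL symplectic similitude whose adelic image lies in `K_δ(1) = GSp_δ(ℤ̂)` has multiplier
`1` or `−1` (`0 < g`, `δ` a polarisation type) — its multiplier is a rational number which is a `ℤ̂`-unit (★ R60-4
`ν(K_δ(1)) ⊆ ℤ̂^×`), and `ℚ^× ∩ ℤ̂^× = {±1}` (★ `ℚ ∩ ℤ̂ = ℤ`). [cite: Milne2005ShimuraVarieties, §6 p. 67 and p. 70]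
[cite: Deligne1971TravauxShimura, Exemple 4.16 p. 150] -/
theorem isMultiplier_eq_one_or_eq_neg_one_of_mem_principalLevelSubgroup_one (hδ : IsPolarizationType δ) (hg : 0 < g)
    {r : gspRational δ} (hr : gspRationalToFinAdelic δ r ∈ principalLevelSubgroup δ 1) {c : ℚˣ}
    (hc : IsMultiplier (typeFormOver δ ℚ) (r : GL (Fin g ⊕ Fin g) ℚ) c) : c = 1 ∨ c = -1 := by
  -- the adelic multiplier `ĉ` of `r̂ ∈ K_δ(1)` is `≡ 1 (mod 1·𝓞̂)` with its inverse, i.e. a `ℤ̂`-unit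
  have hcA : IsMultiplier (typeFormOver δ finAdeleQ) ((gspRationalToFinAdelic δ r : gspFinAdelic δ) : GL (Fin g ⊕ Fin g) finAdeleQ)
      (Units.map (algebraMap ℚ finAdeleQ).toMonoidHom c) := by
    have h := hc.map (algebraMap ℚ finAdeleQ)
    rwa [typeFormOver_map] at h
  obtain ⟨h1, h2⟩ := sub_one_mem_levelIdeal_of_isMultiplier_of_isPolarizationType δ hδ hg hr hcA
  have hint : algebraMap ℚ finAdeleQ (c : ℚ) ∈ FiniteAdeleRing.integralAdeles (𝓞 ℚ) ℚ := by
    have := add_mem (mem_integralAdeles_of_mem_levelIdeal h1) (one_mem (FiniteAdeleRing.integralAdeles (𝓞 ℚ) ℚ))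
    rwa [sub_add_cancel] at this
  have hint' : algebraMap ℚ finAdeleQ ((c⁻¹ : ℚˣ) : ℚ) ∈ FiniteAdeleRing.integralAdeles (𝓞 ℚ) ℚ := by
    have := add_mem (mem_integralAdeles_of_mem_levelIdeal h2) (one_mem (FiniteAdeleRing.integralAdeles (𝓞 ℚ) ℚ))
    rwa [sub_add_cancel, ← map_inv] at this
  -- so `c` and `c⁻¹` are integers
  obtain ⟨z, hz⟩ := exists_int_cast_eq_of_algebraMap_mem_integralAdeles hint
  obtain ⟨z', hz'⟩ := exists_int_cast_eq_of_algebraMap_mem_integralAdeles hint'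
  have hzz' : z * z' = 1 := by
    have h : (z : ℚ) * z' = 1 := by rw [hz, hz', Units.val_inv_eq_inv_val, mul_inv_cancel₀ (Units.ne_zero c)]
    exact_mod_cast h
  rcases Int.eq_one_or_neg_one_of_mul_eq_one hzz' with h | h
  · left
    exact Units.ext (by rw [← hz, h, Int.cast_one, Units.val_one])
  · right
    exact Units.ext (by rw [← hz, h, Int.cast_neg, Int.cast_one, Units.val_neg, Units.val_one])

/-- **The positive type scalar is UNIQUE**: if `a = q̂ k = q̂′ k′` with `k, k′ ∈ K_δ(1)` and `q, q′ ∈ GSp_δ(ℚ)` of POSITIVE multipliers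
`c, c′`, then `c = c′` (`q⁻¹ q′ = k̂ k′⁻¹ ∈ GSp_δ(ℚ) ∩ K_δ(1)` has the positive multiplier `c⁻¹ c′ ∈ {±1}`).  So `c(a)` — the
scalar by which `ψ_δ` must be divided to read the type-`δ` polarisation on `Λ_a` — depends on `a` alone (`0 < g`, `δ` a
polarisation type). [cite: Milne2005ShimuraVarieties, Lemma 5.12 p. 57, §6 p. 67 and p. 70] [cite: Deligne1971TravauxShimura, Exemple 4.16 p. 150] -/
theorem eq_of_isMultiplier_pos_of_mul_eq_mul (hδ : IsPolarizationType δ) (hg : 0 < g) {q q' : gspRational δ}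
    {k k' : gspFinAdelic δ} (hk : k ∈ principalLevelSubgroup δ 1) (hk' : k' ∈ principalLevelSubgroup δ 1)
    (h : gspRationalToFinAdelic δ q * k = gspRationalToFinAdelic δ q' * k') {c c' : ℚˣ}
    (hc : IsMultiplier (typeFormOver δ ℚ) (q : GL (Fin g ⊕ Fin g) ℚ) c)
    (hc' : IsMultiplier (typeFormOver δ ℚ) (q' : GL (Fin g ⊕ Fin g) ℚ) c') (h0 : 0 < (c : ℚ)) (h0' : 0 < (c' : ℚ)) :
    c = c' := by
  -- `(q⁻¹ q′)^ = k k′⁻¹ ∈ K_δ(1)`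
  have e : gspRationalToFinAdelic δ (q⁻¹ * q') = k * k'⁻¹ := by
    rw [map_mul, map_inv, eq_mul_inv_iff_mul_eq, mul_assoc, ← h, inv_mul_cancel_left]
  have hkk : k * k'⁻¹ ∈ principalLevelSubgroup δ 1 := mul_mem hk (inv_mem hk')
  have hmem : gspRationalToFinAdelic δ (q⁻¹ * q') ∈ principalLevelSubgroup δ 1 := e ▸ hkk
  have hmult : IsMultiplier (typeFormOver δ ℚ) ((q⁻¹ * q' : gspRational δ) : GL (Fin g ⊕ Fin g) ℚ) (c⁻¹ * c') := by
    rw [Subgroup.coe_mul, Subgroup.coe_inv]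
    exact hc.inv.mul hc'
  rcases isMultiplier_eq_one_or_eq_neg_one_of_mem_principalLevelSubgroup_one δ hδ hg hmem hmult with h1 | h1
  · rwa [inv_mul_eq_one] at h1
  · exfalso
    have hpos : 0 < ((c⁻¹ * c' : ℚˣ) : ℚ) := by
      rw [Units.val_mul, Units.val_inv_eq_inv_val]
      exact mul_pos (inv_pos.2 h0) h0'
    rw [h1, Units.val_neg, Units.val_one] at hpos
    exact absurd hpos (by norm_num)

/-- **`ν(a) ∈ c(a) · ℤ̂^×`**: if `a = q̂ · k` with `k ∈ K_δ(1)` and `q` of multiplier `c`, then `a` has the multiplier `ĉ · t` for a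
`ℤ̂`-UNIT `t` (all local absolute values `1`; `t = ν(k)`) — so `c(a)` is the positive generator of `ν(a) ℤ̂^× ℚ^× ∩ ℚ^×`, the
scalar the DAG's J1-i row names (`0 < g`, `δ` a polarisation type). [cite: Milne2005ShimuraVarieties, Lemma 5.12 p. 57, §6 p. 70]
[cite: Deligne1971TravauxShimura, Exemple 4.16 p. 150] -/
theorem exists_isMultiplier_map_mul_of_mul_eq (hδ : IsPolarizationType δ) (hg : 0 < g) {q : gspRational δ}
    {k a : gspFinAdelic δ} (hk : k ∈ principalLevelSubgroup δ 1) (h : gspRationalToFinAdelic δ q * k = a) {c : ℚˣ}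
    (hc : IsMultiplier (typeFormOver δ ℚ) (q : GL (Fin g ⊕ Fin g) ℚ) c) :
    ∃ t : finAdeleQˣ, (∀ v : HeightOneSpectrum (𝓞 ℚ), Valued.v ((t : finAdeleQ) v) = 1) ∧
      IsMultiplier (typeFormOver δ finAdeleQ) (a : GL (Fin g ⊕ Fin g) finAdeleQ)
        (Units.map (algebraMap ℚ finAdeleQ).toMonoidHom c * t) := by
  obtain ⟨t, ht⟩ := k.2
  obtain ⟨ht1, ht2⟩ := sub_one_mem_levelIdeal_of_isMultiplier_of_isPolarizationType δ hδ hg hk ht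
  refine ⟨t, (Literature.NumberTheory.Adeles.forall_valued_eq_one_iff_mem_integralAdeles t).2 ⟨?_, ?_⟩, ?_⟩
  · have := add_mem (mem_integralAdeles_of_mem_levelIdeal ht1) (one_mem (FiniteAdeleRing.integralAdeles (𝓞 ℚ) ℚ))
    rwa [sub_add_cancel] at this
  · have := add_mem (mem_integralAdeles_of_mem_levelIdeal ht2) (one_mem (FiniteAdeleRing.integralAdeles (𝓞 ℚ) ℚ))
    rwa [sub_add_cancel] at this
  · -- `ν(q̂ k) = ĉ · t`
    have hcA : IsMultiplier (typeFormOver δ finAdeleQ)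
        ((gspRationalToFinAdelic δ q : gspFinAdelic δ) : GL (Fin g ⊕ Fin g) finAdeleQ)
        (Units.map (algebraMap ℚ finAdeleQ).toMonoidHom c) := by
      have h' := hc.map (algebraMap ℚ finAdeleQ)
      rwa [typeFormOver_map] at h'
    have h1 : IsMultiplier (typeFormOver δ finAdeleQ)
        ((gspRationalToFinAdelic δ q * k : gspFinAdelic δ) : GL (Fin g ⊕ Fin g) finAdeleQ)
        (Units.map (algebraMap ℚ finAdeleQ).toMonoidHom c * t) := by
      rw [Subgroup.coe_mul]
      exact hcA.mul ht
    rwa [h] at h1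

end TypeScalar

end Literature.AlgebraicGeometry.ModuliOfAbelianVarieties

end
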